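import Summits.QuantumFields.BalabanUV.T4Continuum.Support.BoundaryRateSliceGeometry

/-!
# BoundaryRateSliceGeometrySharp — part 2 of `BoundaryRateSliceGeometry`: the two located NECESSITIES of the slice geometry count
on the nested-interval geometry — the volume entropy `V ≥ L`, and the output's SURPLUS decay (no `(Mc, V)` without it; none with
unit weights) (cell `pub-balaban`, T⁴ fan-out, `HOME/BINDER-OWNERS.md` row NE5, route P3 «boundary-functional member»; ROUND-2
skeleton `t4/skeletons/NE5-t4-ne5-p3.md` §3 L14, §7 row B1; lineage t4-ne5-p3 gen 17; [folklore] finite sums; imports the sibling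
cell module `Support.BoundaryRateSliceGeometry` ONLY; same namespace)

HONEST FRAMING (T4-DAG PAGE 1; identical to part 1's).  The cell's T⁴ target is rung (B)+1: existence AND uniqueness of the
ε → 0 limit of Bałaban's unit-scale averaged loop expectations on a FIXED finite torus — NOT infinite volume, NOT a mass gap, NOT
the Clay problem.  HONEST DEPENDENCY (cell line, verbatim): «continuum YM on T⁴ ⇐ BetaPertH ∧ nine spine estimates (0/9 proved);
BetaPertH ⇐ (D1) ∧ (D4) ∧ CAP+tail; G-an2-4 gates asym, D1 and NE2/3/4.»  A TOY GEOMETRY: nothing of Bałaban's domains is modelled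
or asserted; `T4BoundaryCarrier.NE5B` is NOT PRINTED and NOT proved here.

CONTENTS.  §4 `iv_volume_forced`: ANY `(Mc, V ≥ 0)` for which part 1's slice count holds (surplus weight) has `V ≥ L` — single-block
outputs have `L^{n−j}` single-block parents of step `j` —, so the boundary member's smallness on honest geometry is `δ·L^d < θ`, the
dimension in the exponent (cell GAPS G-ne5p3-3).  §5 `iv_not_sliceCountGrowing_noSurplus`: with the output weight at the SAME rate
(`κ₁ = κ`, no surplus) NO `(Mc, V)` exists — the kernel reading of [Balaban1988Convergent] p. 262 *"Such improved bounds are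
needed"* —; `iv_not_sliceCountGrowing_one`: with UNIT weights — the form in which the parent's END faces
`T4BoundaryRateCollar.ne5B_of_collar` / `ne5B_of_frame` / `ne5B_of_pathFrame` take the slice count — NO `(Mc, V)` exists either
(`κ ≥ 0`): the located reason for the weighted END faces `Support/BoundaryRateWeightedTilt.ne5B_of_pathFrame₂` etc.
Names used — part 1: `ivCarriers`, `ivGeneration`, `ivParents`, `span`, `base`, `outDecay`, `outDecay_apply`, `outDecay_pos`,
`filter_parents`, `sum_blocks_le`; `T4BoundaryRate.SliceCountGrowing`; Mathlib: `pow_unbounded_of_one_lt`, `Nat.le_ceil`. -/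

namespace Summit.QuantumFields.BalabanUV.T4Continuum.BoundaryRateSliceGeometry

open Finset
open Literature.MathematicalPhysics.QuantumFieldTheory.Balaban1983to89
open T4OutputRate T4BoundaryCarrier T4BoundaryRate

variable (L : ℕ)

/-! ## §4 NECESSITY OF THE VOLUME ENTROPY: `V ≥ L` -/

/-- Lower bound at a single-block output: the scale-`j` slice sum of the surplus-weighted decay is at least the number of single
scale-`j` blocks, `L^{n − j}`. [folklore] -/
theorem pow_le_sliceSum (κ κ₁ : ℝ) {n j : ℕ} (hj : j < n) :
    (L : ℝ) ^ (n - j) ≤ ∑ Y ∈ (ivParents L (n, 0, 0)).filter (fun Y => Y.1 = j),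
      outDecay ivCarriers κ₁ (n, 0, 0) Y * Real.exp (-(κ * (Y.2.2 : ℝ))) := by
  rw [filter_parents L (X := (n, 0, 0)) hj]
  have h := sum_blocks_le L (n, 0, 0) j
    (f := fun Y => outDecay ivCarriers κ₁ (n, 0, 0) Y * Real.exp (-(κ * (Y.2.2 : ℝ))))
    (fun Y => mul_nonneg (outDecay_pos κ₁ _ Y).le (Real.exp_pos _).le)
  have hval : ∀ p ∈ range (span L (n, 0, 0) j),
      (fun Y : ℕ × ℕ × ℕ => outDecay ivCarriers κ₁ (n, 0, 0) Y * Real.exp (-(κ * (Y.2.2 : ℝ)))) (j, base L (n, 0, 0) j + p, 0)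
        = 1 := by
    intro p _
    simp [outDecay]
  rw [sum_congr rfl hval, sum_const, card_range, nsmul_eq_mul, mul_one] at h
  have hspan : (span L (n, 0, 0) j : ℝ) = (L : ℝ) ^ (n - j) := by
    simp [span]
  rw [hspan] at h
  exact h

/-- **THE VOLUME ENTROPY IS NECESSARY** [folklore]: if the slice count holds on the nested-interval geometry (surplus weight, any
`κ, κ₁`) with some `Mc` and some `V ≥ 0`, then `V ≥ L`.  So on honest geometry the boundary member's smallness is `δ·L^d < θ` with the
dimension in the exponent, not `δ < θ`. -/
theorem iv_volume_forced (hL : 1 ≤ L) {κ κ₁ Mc V : ℝ} (hV : 0 ≤ V)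
    (hS : SliceCountGrowing (ivGeneration L) κ (outDecay ivCarriers κ₁) Mc V) : (L : ℝ) ≤ V := by
  by_contra hlt
  push Not at hlt
  have hL1 : (1 : ℝ) ≤ L := by exact_mod_cast hL
  -- at single-block outputs: L^Δ ≤ Mc·V^Δ for every Δ > 0
  have key : ∀ Δ : ℕ, 0 < Δ → (L : ℝ) ^ Δ ≤ Mc * V ^ Δ := by
    intro Δ hΔ
    have h := hS (Δ, 0, 0) 0 (mem_range.mpr hΔ)
    have h1 := pow_le_sliceSum L κ κ₁ (n := Δ) (j := 0) hΔ
    have h2 : ∑ Y ∈ (ivParents L (Δ, 0, 0)).filter (fun Y => Y.1 = 0),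
        outDecay ivCarriers κ₁ (Δ, 0, 0) Y * Real.exp (-(κ * (Y.2.2 : ℝ))) ≤ Mc * V ^ (Δ - 0) * Real.exp (-(κ * ((0 : ℕ) : ℝ))) :=
      h
    simp only [Nat.sub_zero, Nat.cast_zero, mul_zero, neg_zero, Real.exp_zero, mul_one] at h1 h2
    exact h1.trans h2
  rcases hV.eq_or_lt with hV0 | hVpos
  · have h := key 1 one_pos
    rw [← hV0] at h
    simp at h
    linarith
  · have hr : 1 < (L : ℝ) / V := (one_lt_div hVpos).mpr hlt
    have hq : ∀ Δ : ℕ, 0 < Δ → ((L : ℝ) / V) ^ Δ ≤ Mc := by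
      intro Δ hΔ
      rw [div_pow, div_le_iff₀ (pow_pos hVpos Δ)]
      exact key Δ hΔ
    obtain ⟨n, hn⟩ := pow_unbounded_of_one_lt Mc hr
    rcases Nat.eq_zero_or_pos n with rfl | hnpos
    · simp only [pow_zero] at hn
      have h := hq 1 one_pos
      rw [pow_one] at h
      linarith
    · exact absurd (hq n hnpos) (not_le.mpr hn)

/-! ## §5 NECESSITY OF THE SURPLUS, and the unit-weight NO-GO -/

/-- Lower bound at the outputs `(1, 0, e)`: the step-`0` slice sum of a weight depending on the output only is at least
`(e + 1)·L` single-block parents times the weight. [folklore] -/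
theorem mul_le_sliceSum (κ : ℝ) {w : ℝ} (hw : 0 ≤ w) (e : ℕ) :
    ((e : ℝ) + 1) * L * w ≤ ∑ Y ∈ (ivParents L (1, 0, e)).filter (fun Y => Y.1 = 0),
      w * Real.exp (-(κ * (Y.2.2 : ℝ))) := by
  rw [filter_parents L (X := (1, 0, e)) (j := 0) one_pos]
  have h := sum_blocks_le L (1, 0, e) 0 (f := fun Y => w * Real.exp (-(κ * (Y.2.2 : ℝ))))
    (fun Y => mul_nonneg hw (Real.exp_pos _).le)
  have hval : ∀ p ∈ range (span L (1, 0, e) 0),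
      (fun Y : ℕ × ℕ × ℕ => w * Real.exp (-(κ * (Y.2.2 : ℝ)))) (0, base L (1, 0, e) 0 + p, 0) = w := by
    intro p _
    simp
  rw [sum_congr rfl hval, sum_const, card_range, nsmul_eq_mul] at h
  have hspan : (span L (1, 0, e) 0 : ℝ) = ((e : ℝ) + 1) * L := by
    simp [span]
  rw [hspan] at h
  exact h

/-- **WITHOUT SURPLUS, NO SLICE COUNT** [folklore]: with the output-decay weight at the SAME rate `κ₁ = κ` (no surplus decay of the new
terms) the nested-interval geometry admits NO `(Mc, V)` at all — the kernel reading of p. 262's *"Such improved bounds are needed"*: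
the outputs `(1, 0, e)` have `(e + 1)·L` single-block parents of step `0`, each contributing `e^{−κe}`, against `Mc·V·e^{−κe}`. -/
theorem iv_not_sliceCountGrowing_noSurplus (hL : 1 ≤ L) (κ Mc V : ℝ) :
    ¬ SliceCountGrowing (ivGeneration L) κ (outDecay ivCarriers κ) Mc V := by
  intro hS
  have hL1 : (1 : ℝ) ≤ L := by exact_mod_cast hL
  have key : ∀ e : ℕ, ((e : ℝ) + 1) * L ≤ Mc * V := by
    intro e
    have h := hS (1, 0, e) 0 (mem_range.mpr one_pos)
    have h2 : ∑ Y ∈ (ivParents L (1, 0, e)).filter (fun Y => Y.1 = 0),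
        outDecay ivCarriers κ (1, 0, e) Y * Real.exp (-(κ * (Y.2.2 : ℝ))) ≤
        Mc * V ^ (1 - 0) * Real.exp (-(κ * ((e : ℕ) : ℝ))) := h
    have h1 := mul_le_sliceSum L κ (w := outDecay ivCarriers κ (1, 0, e) (1, 0, e)) (outDecay_pos κ _ _).le e
    simp only [outDecay_apply] at h1 h2
    have hw : 0 < Real.exp (-(κ * ((e : ℕ) : ℝ))) := Real.exp_pos _
    have h3 : ((e : ℝ) + 1) * L * Real.exp (-(κ * ((e : ℕ) : ℝ))) ≤ Mc * V * Real.exp (-(κ * ((e : ℕ) : ℝ))) := by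
      have := h1.trans h2
      simpa [pow_one] using this
    exact le_of_mul_le_mul_right h3 hw
  have h := key ⌈Mc * V⌉₊
  have hceil : Mc * V ≤ (⌈Mc * V⌉₊ : ℝ) := Nat.le_ceil _
  nlinarith [h, hceil, hL1, Nat.cast_nonneg (α := ℝ) ⌈Mc * V⌉₊]

/-- **THE UNIT-WEIGHT SLICE COUNT IS NOT INHABITABLE** [folklore] (`κ ≥ 0`): with unit weights — the form in which the parent's END faces
`T4BoundaryRateCollar.ne5B_of_collar` / `ne5B_of_frame` / `ne5B_of_pathFrame` take the slice count — the nested-interval geometry admits NO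
`(Mc, V)`: the outputs `(1, 0, e)` have `(e + 1)·L` single-block parents of step `0` against `Mc·V·e^{−κe} ≤ max(Mc·V, 0)`.  The located
reason for the weighted END faces of `Support/BoundaryRateWeightedTilt`. -/
theorem iv_not_sliceCountGrowing_one (hL : 1 ≤ L) {κ : ℝ} (hκ : 0 ≤ κ) (Mc V : ℝ) :
    ¬ SliceCountGrowing (ivGeneration L) κ (fun _ _ => 1) Mc V := by
  intro hS
  have hL1 : (1 : ℝ) ≤ L := by exact_mod_cast hL
  have key : ∀ e : ℕ, ((e : ℝ) + 1) * L ≤ Mc * V * Real.exp (-(κ * (e : ℝ))) := by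
    intro e
    have h := hS (1, 0, e) 0 (mem_range.mpr one_pos)
    have h2 : ∑ Y ∈ (ivParents L (1, 0, e)).filter (fun Y => Y.1 = 0),
        (1 : ℝ) * Real.exp (-(κ * (Y.2.2 : ℝ))) ≤ Mc * V ^ (1 - 0) * Real.exp (-(κ * ((e : ℕ) : ℝ))) := h
    have h1 := mul_le_sliceSum L κ (w := (1 : ℝ)) zero_le_one e
    rw [mul_one] at h1
    have := h1.trans h2
    simpa [pow_one] using this
  by_cases hMV : 0 ≤ Mc * V
  · have key' : ∀ e : ℕ, ((e : ℝ) + 1) * L ≤ Mc * V := by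
      intro e
      have hexp : Real.exp (-(κ * (e : ℝ))) ≤ 1 :=
        Real.exp_le_one_iff.mpr (by have := mul_nonneg hκ (Nat.cast_nonneg e); linarith)
      exact (key e).trans (by nlinarith [hexp, hMV])
    have h := key' ⌈Mc * V⌉₊
    have hceil : Mc * V ≤ (⌈Mc * V⌉₊ : ℝ) := Nat.le_ceil _
    nlinarith [h, hceil, hL1, Nat.cast_nonneg (α := ℝ) ⌈Mc * V⌉₊]
  · push Not at hMV
    have h := key 0
    simp only [Nat.cast_zero, zero_add, one_mul, mul_zero, neg_zero, Real.exp_zero, mul_one] at h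
    linarith

end Summit.QuantumFields.BalabanUV.T4Continuum.BoundaryRateSliceGeometry
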